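import Summits.QuantumFields.QCD.Theses.SpectralDefectExtinction
import Literature.MathematicalPhysics.QuantumFieldTheory.SpectralDefectDensity
import Literature.Barriers.QuantumFields.WilsonDeterminantMassSplitting
import Literature.MathematicalPhysics.QuantumLattice.OverlapLocality
import Summits.QuantumFields.QCD.Theorems.SpectralDefectExtinctionTipNoBindingStubPositivity

/-!
# Crux `WegnerEstimate` (item stmt-QuantumFields-8966), negative side — Wilson-positivity reduction

Support file of the standing disprover (`refuter-cdisprove-stmt-QuantumFields-8966-0`); sibling of
`Negative/LoadBearing.lean`.  The crux counts eigenvalues of the Hermitian Wilson–Dirac operator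
`γ₅ D_W(U, m₀, 1)` in `(-ε, ε)`, i.e. singular values of `D_W(U,m₀,1)` below `ε`.  Proved here
(theorem-only, sorry-free):

* `exists_eigenvector_of_countP_pos` (spectral theorem) and
  `exists_re_form_lt_of_window`: a window eigenvalue forces a UNIT spinor `v` with
  `Re⟨v, D_W(U,0,1) v⟩ < ε - m₀` (`D v = λ Γ₅ v`, `|Re⟨v,Γ₅v⟩| ≤ 1`, `D(m₀) = D(0) + m₀`);
* `exists_dirichlet_lt_of_window`: with tree `stub_positivity`
  (`Re⟨v, D_W(U,0,1)v⟩ = ½ Σ |U(x,μ)v(x+μ̂) - v(x)|²`) the covariant Dirichlet energy of `v` is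
  `< ε - m₀` — so the `m₀ = 0` endpoint of the crux is implied by an integrated-density-of-states
  bound at the bottom of the random covariant Laplacian (by min–max even
  `N(ε;U,m₀) ≤ 4·#{eig ½Δ_U < ε - m₀}`, not formalised), while at `m₀ < 0` the sublevel
  `{Dirichlet < |m₀|}` is macroscopic and the content is pseudospectral;
* `windowCount_eq_zero_of_le_mass`: for `ε ≤ m₀` the window is empty on every configuration
  (positive-mass gap `|spec γ₅D_W(U,m₀,1)| ≥ m₀`);
* `countP_pos_of_small_image`, `window_pos_of_small_image` (converse): a unit spinor with
  `‖D_W(U,m₀,1) v‖ < ε` forces `N(ε; U, m₀) ≥ 1` — the entry point for lower bounds (toron and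
  defect modes); a lower bound on `E N` needs in addition measurability of the count in `U` and a
  small-ball lower bound for the Wilson measure, neither formalised.

* `wilsonDirac_one_mulVec_const`, `window_one_pos` (free toron modes): at `U = 1` the constant
  colour–spinors satisfy `D_W(1,m₀,1)v = m₀ v`, hence `N(ε; 1, m₀) ≥ 1` for every `ε > |m₀|` on
  every torus — the configuration-wise anchor of the toron floor.

[folklore] linear algebra throughout.
-/

namespace Summit.QuantumFields.QCD.Theorems.WegnerEstimateNegative

open MeasureTheory
open scoped Matrix
open Literature.MathematicalPhysics.QuantumLattice Literature.MathematicalPhysics.QuantumFieldTheory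
  Literature.Probability.LatticeModels
open Literature.Barriers.QuantumFields (wilsonDirac_add_mass isHermitian_gammaFive_mul_wilsonDirac)
open Matrix

/-! ## Wilson-positivity reduction -/

section Reduction

variable {n : Type*} [Fintype n] [DecidableEq n]

/-- A Hermitian matrix whose characteristic polynomial has a root with `|Re z| < ε` has a unit
eigenvector with eigenvalue `λ`, `|λ| < ε` (spectral theorem, `Matrix.IsHermitian.eigenvectorBasis`).
[folklore] -/
theorem exists_eigenvector_of_countP_pos {A : Matrix n n ℂ} (hA : A.IsHermitian) {ε : ℝ}
    (h : 0 < A.charpoly.roots.countP (fun z : ℂ => |z.re| < ε)) :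
    ∃ (lam : ℝ) (v : n → ℂ), |lam| < ε ∧ (∑ i, ‖v i‖ ^ 2 = 1) ∧ A *ᵥ v = (lam : ℂ) • v := by
  rw [Multiset.countP_pos] at h
  obtain ⟨z, hz, hzε⟩ := h
  rw [hA.roots_charpoly_eq_eigenvalues] at hz
  obtain ⟨i, -, rfl⟩ := Multiset.mem_map.1 hz
  refine ⟨hA.eigenvalues i, ⇑(hA.eigenvectorBasis i), ?_, ?_, ?_⟩
  · simpa using hzε
  · have h1 : ‖hA.eigenvectorBasis i‖ = 1 := (hA.eigenvectorBasis).orthonormal.1 i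
    rw [EuclideanSpace.norm_eq] at h1
    have h2 : ∑ j, ‖(hA.eigenvectorBasis i) j‖ ^ 2 = 1 := by
      have := congrArg (· ^ 2) h1
      simp only [one_pow] at this
      rwa [Real.sq_sqrt (Finset.sum_nonneg fun j _ => by positivity)] at this
    exact h2
  · exact hA.mulVec_eigenvectorBasis i

omit [DecidableEq n] in
/-- `Re⟨v, v⟩ = Σ ‖v i‖²`. [folklore] -/
theorem re_star_dotProduct_self (v : n → ℂ) : (star v ⬝ᵥ v).re = ∑ i, ‖v i‖ ^ 2 := by
  rw [dotProduct, Complex.re_sum]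
  refine Finset.sum_congr rfl fun i _ => ?_
  rw [Pi.star_apply, Complex.star_def, Complex.conj_mul', ← Complex.ofReal_pow, Complex.ofReal_re]

omit [Fintype n] [DecidableEq n] in
/-- `|Re(conj z · s · z)| ≤ ‖z‖²` for a sign `s = ±1`. [folklore] -/
theorem abs_re_conj_mul_sign_mul_le (z s : ℂ) (hs : s = 1 ∨ s = -1) :
    |(star z * (s * z)).re| ≤ ‖z‖ ^ 2 := by
  rcases hs with rfl | rfl
  · rw [one_mul, Complex.star_def, Complex.conj_mul', ← Complex.ofReal_pow, Complex.ofReal_re,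
      abs_of_nonneg (by positivity)]
  · rw [neg_one_mul, mul_neg, Complex.neg_re, abs_neg, Complex.star_def, Complex.conj_mul',
      ← Complex.ofReal_pow, Complex.ofReal_re, abs_of_nonneg (by positivity)]

/-- **Wilson-positivity reduction (configuration-wise).**  If `γ₅ D_W(U, m₀, 1)` has an eigenvalue
in `(-ε, ε)` — i.e. `D_W(U, m₀, 1)` has a singular value `< ε` — then some UNIT spinor `v` has
`Re⟨v, D_W(U,0,1) v⟩ < ε - m₀`.  (From `D v = λ Γ₅ v` for the eigenvector: `Re⟨v,Dv⟩ = λ Re⟨v,Γ₅v⟩ ≤ |λ|`,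
and `D(m₀) = D(0) + m₀`.)  With Wilson positivity `Re⟨v, D_W(U,0,1)v⟩ = ½ Σ_{x,μ} |U(x,μ)v(x+μ̂) - v(x)|²`
(tree `stub_positivity`) this says: a window eigenvalue at bare mass `m₀ ≤ 0` needs a colour–spinor
field whose covariant Dirichlet energy is `< ε + |m₀|`; by min–max (not formalised) even
`N(ε; U, m₀) ≤ 4 · #{eigenvalues of ½Δ_U^colour < ε - m₀}`.  Consequences: (i) the `m₀ = 0` endpoint of
the crux FOLLOWS from an integrated-density-of-states bound at the bottom of the random covariant
Laplacian, `E #{eig ½Δ_U ≤ ε} ≤ C(1+β^p) ε L⁴/4` (Lifshitz-tail territory at strong coupling; torons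
give onset `ε ≍ β^{-1/2}/8` on `2⁴`, so `p ≥ 1/2` on that route); (ii) for `m₀ < 0` the sublevel
`{Dirichlet < |m₀|}` is macroscopic — the content of the crux at negative bare mass is pseudospectral
(landing of defect/pseudo-modes inside the Wilson hole), untouched by positivity. [folklore] -/
theorem exists_re_form_lt_of_window {L : ℕ} [NeZero L] (U : GaugeConfig 4 L SU3) (m₀ ε : ℝ)
    (h : 0 < Multiset.countP (fun z : ℂ => |z.re| < ε) (spinorLift gammaFive * wilsonDirac (fundamentalRep (Fin 3)) U m₀ 1).charpoly.roots) :
    ∃ v : QuarkIdx L → ℂ, (∑ i, ‖v i‖ ^ 2 = 1) ∧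
      (star v ⬝ᵥ (wilsonDirac (fundamentalRep (Fin 3)) U 0 1 *ᵥ v)).re < ε - m₀ := by
  have hρ : ∀ g, fundamentalRep (Fin 3) g ∈ Matrix.unitaryGroup (Fin 3) ℂ :=
    fundamentalRep_mem_unitaryGroup
  set Γ : Matrix (QuarkIdx L) (QuarkIdx L) ℂ := spinorLift gammaFive with hΓ
  set D : Matrix (QuarkIdx L) (QuarkIdx L) ℂ := wilsonDirac (fundamentalRep (Fin 3)) U m₀ 1 with hD
  have hH : (Γ * D).IsHermitian := isHermitian_gammaFive_mul_wilsonDirac _ hρ U m₀ 1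
  obtain ⟨lam, v, hlam, hv1, hv⟩ := exists_eigenvector_of_countP_pos hH h
  refine ⟨v, hv1, ?_⟩
  have hΓΓ : Γ * Γ = 1 := spinorLift_gammaFive_mul_self
  have hDv : D *ᵥ v = (lam : ℂ) • (Γ *ᵥ v) := by
    calc D *ᵥ v = (Γ * (Γ * D)) *ᵥ v := by rw [← Matrix.mul_assoc, hΓΓ, Matrix.one_mul]
      _ = Γ *ᵥ ((Γ * D) *ᵥ v) := by rw [Matrix.mulVec_mulVec]
      _ = Γ *ᵥ ((lam : ℂ) • v) := by rw [hv]
      _ = (lam : ℂ) • (Γ *ᵥ v) := by rw [Matrix.mulVec_smul]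
  -- `|Re⟨v, Γ v⟩| ≤ 1`
  have hΓform : |(star v ⬝ᵥ (Γ *ᵥ v)).re| ≤ 1 := by
    rw [hΓ, spinorLift_gammaFive_eq_diagonal, dotProduct, Complex.re_sum]
    refine (Finset.abs_sum_le_sum_abs _ _).trans ?_
    refine (Finset.sum_le_sum fun i _ => ?_).trans_eq hv1
    rw [mulVec_diagonal, Pi.star_apply]
    refine abs_re_conj_mul_sign_mul_le (v i) _ ?_
    obtain ⟨x, a, α⟩ := i
    fin_cases α <;> simp
  -- `Re⟨v, D v⟩ < ε`
  have hDform : (star v ⬝ᵥ (D *ᵥ v)).re < ε := by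
    rw [hDv, dotProduct_smul, smul_eq_mul, Complex.re_ofReal_mul]
    calc lam * (star v ⬝ᵥ Γ *ᵥ v).re ≤ |lam * (star v ⬝ᵥ Γ *ᵥ v).re| := le_abs_self _
      _ = |lam| * |(star v ⬝ᵥ Γ *ᵥ v).re| := abs_mul _ _
      _ ≤ |lam| * 1 := mul_le_mul_of_nonneg_left hΓform (abs_nonneg _)
      _ < ε := by rw [mul_one]; exact hlam
  -- `Re⟨v, D v⟩ = Re⟨v, D₀ v⟩ + m₀`
  have hsplit : (star v ⬝ᵥ (D *ᵥ v)).re =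
      (star v ⬝ᵥ (wilsonDirac (fundamentalRep (Fin 3)) U 0 1 *ᵥ v)).re + m₀ := by
    have hadd := wilsonDirac_add_mass (fundamentalRep (Fin 3)) U 0 m₀ 1
    rw [zero_add] at hadd
    rw [hD, hadd, add_mulVec, smul_mulVec, one_mulVec, dotProduct_add, dotProduct_smul,
      smul_eq_mul, Complex.add_re, Complex.re_ofReal_mul, re_star_dotProduct_self, hv1, mul_one]
  linarith

/-- **Dirichlet form version** (with tree `stub_positivity`): a window eigenvalue of
`γ₅ D_W(U,m₀,1)` in `(-ε,ε)` forces a unit colour–spinor field with covariant Dirichlet energy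
`½ Σ_{x,μ,a,α} |Σ_b U(x,μ)_{ab} v(x+μ̂,b,α) - v(x,a,α)|² < ε - m₀`. [folklore] -/
theorem exists_dirichlet_lt_of_window {L : ℕ} [NeZero L] (U : GaugeConfig 4 L SU3) (m₀ ε : ℝ)
    (h : 0 < Multiset.countP (fun z : ℂ => |z.re| < ε) (spinorLift gammaFive * wilsonDirac (fundamentalRep (Fin 3)) U m₀ 1).charpoly.roots) :
    ∃ v : QuarkIdx L → ℂ, (∑ i, ‖v i‖ ^ 2 = 1) ∧
      (1 / 2) * ∑ x, ∑ μ, ∑ a, ∑ α,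
          ‖(∑ b, (U (x, μ) : Matrix (Fin 3) (Fin 3) ℂ) a b *
              v (Site.shift x μ, b, α)) - v (x, a, α)‖ ^ 2 < ε - m₀ := by
  obtain ⟨v, hv1, hv⟩ := exists_re_form_lt_of_window U m₀ ε h
  refine ⟨v, hv1, ?_⟩
  rwa [Summit.QuantumFields.QCD.Cruxes.TipNoBinding.PositivityNoLeakSpread.stub_positivity L U v]
    at hv

/-- **Positive-mass gap** (why `m₀ ≤ 0` is where the content is): for `ε ≤ m₀` the window is empty
on EVERY configuration — `|spec γ₅ D_W(U,m₀,1)| ≥ m₀` by Wilson positivity. [folklore] -/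
theorem windowCount_eq_zero_of_le_mass {L : ℕ} [NeZero L] (U : GaugeConfig 4 L SU3) {m₀ ε : ℝ}
    (hε : ε ≤ m₀) : Multiset.countP (fun z : ℂ => |z.re| < ε) (spinorLift gammaFive * wilsonDirac (fundamentalRep (Fin 3)) U m₀ 1).charpoly.roots = 0 := by
  by_contra hne
  obtain ⟨v, -, hv⟩ := exists_dirichlet_lt_of_window U m₀ ε (Nat.pos_of_ne_zero hne)
  have : (0 : ℝ) ≤ (1 / 2) * ∑ x, ∑ μ, ∑ a, ∑ α,
      ‖(∑ b, (U (x, μ) : Matrix (Fin 3) (Fin 3) ℂ) a b *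
          v (Site.shift x μ, b, α)) - v (x, a, α)‖ ^ 2 := by positivity
  linarith

end Reduction

/-! ### Converse direction: small image ⇒ window eigenvalue (entry point for lower bounds) -/

section Converse

variable {n : Type*} [Fintype n] [DecidableEq n]

/-- An isometry preserves the `ℓ²` sum. [folklore] -/
theorem sum_norm_sq_mulVec_of_isometry {A : Matrix n n ℂ} (hA : Aᴴ * A = 1) (w : n → ℂ) :
    ∑ i, ‖(A *ᵥ w) i‖ ^ 2 = ∑ i, ‖w i‖ ^ 2 := by
  rw [← re_star_dotProduct_self, ← re_star_dotProduct_self, star_mulVec, ← dotProduct_mulVec,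
    mulVec_mulVec, hA, one_mulVec]

/-- The `ℓ²` sum of `diagonal d *ᵥ w`. [folklore] -/
theorem sum_norm_sq_diagonal_mulVec (d : n → ℂ) (w : n → ℂ) :
    ∑ i, ‖(diagonal d *ᵥ w) i‖ ^ 2 = ∑ i, ‖d i‖ ^ 2 * ‖w i‖ ^ 2 := by
  refine Finset.sum_congr rfl fun i _ => ?_
  rw [mulVec_diagonal, norm_mul, mul_pow]

/-- A unit vector `v` with `‖A v‖ < ε` forces an eigenvalue of the Hermitian `A` in `(-ε, ε)`
(spectral theorem: `‖Av‖² = Σ_j λ_j² |⟨e_j, v⟩|²`). [folklore] -/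
theorem countP_pos_of_small_image {A : Matrix n n ℂ} (hA : A.IsHermitian) {ε : ℝ} (hε : 0 ≤ ε)
    (v : n → ℂ) (hv1 : ∑ i, ‖v i‖ ^ 2 = 1) (hv : ∑ i, ‖(A *ᵥ v) i‖ ^ 2 < ε ^ 2) :
    0 < A.charpoly.roots.countP (fun z : ℂ => |z.re| < ε) := by
  by_contra h0
  have h0' : A.charpoly.roots.countP (fun z : ℂ => |z.re| < ε) = 0 := by omega
  rw [Multiset.countP_eq_zero] at h0'
  have hlam : ∀ j, ε ≤ |hA.eigenvalues j| := by
    intro j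
    have hmem : ((hA.eigenvalues j : ℝ) : ℂ) ∈ A.charpoly.roots := by
      rw [hA.roots_charpoly_eq_eigenvalues]
      exact Multiset.mem_map.2 ⟨j, Finset.mem_univ_val j, rfl⟩
    have := h0' _ hmem
    simpa using this
  set U : Matrix n n ℂ := (hA.eigenvectorUnitary : Matrix n n ℂ) with hUdef
  have hUmem := (hA.eigenvectorUnitary).2
  have hU1 : star U * U = 1 := Unitary.star_mul_self_of_mem hUmem
  have hU2 : U * star U = 1 := Unitary.mul_star_self_of_mem hUmem
  have hspec : A = U * diagonal (RCLike.ofReal ∘ hA.eigenvalues) * star U := hA.spectral_theorem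
  set w : n → ℂ := star U *ᵥ v with hw
  have hw1 : ∑ i, ‖w i‖ ^ 2 = 1 := by
    rw [hw, sum_norm_sq_mulVec_of_isometry (by simpa [Matrix.star_eq_conjTranspose] using hU2), hv1]
  have hAv : A *ᵥ v = U *ᵥ (diagonal (RCLike.ofReal ∘ hA.eigenvalues) *ᵥ w) := by
    rw [hw, mulVec_mulVec, mulVec_mulVec, ← hspec]
  have hsum : ∑ i, ‖(A *ᵥ v) i‖ ^ 2 =
      ∑ i, ‖((RCLike.ofReal ∘ hA.eigenvalues) i : ℂ)‖ ^ 2 * ‖w i‖ ^ 2 := by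
    rw [hAv, sum_norm_sq_mulVec_of_isometry (by simpa [Matrix.star_eq_conjTranspose] using hU1),
      sum_norm_sq_diagonal_mulVec]
  have hge : ε ^ 2 ≤ ∑ i, ‖((RCLike.ofReal ∘ hA.eigenvalues) i : ℂ)‖ ^ 2 * ‖w i‖ ^ 2 := by
    calc ε ^ 2 = ∑ i, ε ^ 2 * ‖w i‖ ^ 2 := by rw [← Finset.mul_sum, hw1, mul_one]
      _ ≤ _ := Finset.sum_le_sum fun i _ => by
          refine mul_le_mul_of_nonneg_right ?_ (by positivity)
          have h1 : ‖((RCLike.ofReal ∘ hA.eigenvalues) i : ℂ)‖ = |hA.eigenvalues i| := by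
            simp
          rw [h1]
          exact pow_le_pow_left₀ hε (hlam i) 2
  rw [hsum] at hv
  linarith

/-- The `Γ₅`-lift is an entrywise sign: it preserves the `ℓ²` sum. [folklore] -/
theorem sum_norm_sq_spinorLift_gammaFive_mulVec {L : ℕ} [NeZero L] (w : QuarkIdx L → ℂ) :
    ∑ i, ‖((spinorLift gammaFive : Matrix (QuarkIdx L) (QuarkIdx L) ℂ) *ᵥ w) i‖ ^ 2 =
      ∑ i, ‖w i‖ ^ 2 := by
  rw [spinorLift_gammaFive_eq_diagonal]
  refine Finset.sum_congr rfl fun i _ => ?_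
  rw [mulVec_diagonal, norm_mul]
  obtain ⟨x, a, α⟩ := i
  fin_cases α <;> simp

/-- **Singular-value criterion (converse direction).**  A unit spinor `v` with
`‖D_W(U,m₀,1) v‖ < ε` forces `N(ε; U, m₀) ≥ 1` — the entry point for LOWER bounds on the window
count (toron modes: at `U = 1` the constant spinors have `D_W(1,m₀,1)v = m₀ v`, so
`N(ε; 1, m₀) ≥ 1` for `ε > |m₀|`; defect modes).  A rigorous lower bound on `E N` needs in addition
the a.e.-strong measurability of the count in `U` (it is Borel: lower semicontinuous) and a lower
bound on the Wilson measure of a neighbourhood — neither formalised. [folklore] -/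
theorem window_pos_of_small_image {L : ℕ} [NeZero L] (U : GaugeConfig 4 L SU3) {m₀ ε : ℝ}
    (hε : 0 ≤ ε) (v : QuarkIdx L → ℂ) (hv1 : ∑ i, ‖v i‖ ^ 2 = 1)
    (hv : ∑ i, ‖(wilsonDirac (fundamentalRep (Fin 3)) U m₀ 1 *ᵥ v) i‖ ^ 2 < ε ^ 2) :
    0 < Multiset.countP (fun z : ℂ => |z.re| < ε)
      (spinorLift gammaFive * wilsonDirac (fundamentalRep (Fin 3)) U m₀ 1).charpoly.roots := by
  have hρ : ∀ g, fundamentalRep (Fin 3) g ∈ Matrix.unitaryGroup (Fin 3) ℂ :=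
    fundamentalRep_mem_unitaryGroup
  have hH := isHermitian_gammaFive_mul_wilsonDirac _ hρ U m₀ 1
  refine countP_pos_of_small_image hH hε v hv1 ?_
  rwa [← mulVec_mulVec, sum_norm_sq_spinorLift_gammaFive_mulVec]

end Converse

/-! ### The trivial configuration: constant modes, `N(ε; 1, m₀) ≥ 1` for `ε > |m₀|` -/

section FreeToron

/-- Forward hop of a constant field at `U = 1`, generic spin matrix `T`. [folklore] -/
theorem sum_fwd_const {L : ℕ} [NeZero L] (p : QuarkIdx L) (μ : Fin 4)
    (T : Matrix (Fin 4) (Fin 4) ℂ) (c : Fin 3 × Fin 4 → ℂ) (k : ℂ) :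
    ∑ q : QuarkIdx L, (if q.1 = Site.shift p.1 μ then
        k * (T p.2.2 q.2.2 * (1 : Matrix (Fin 3) (Fin 3) ℂ) p.2.1 q.2.1) * c q.2 else 0)
      = k * ∑ β, T p.2.2 β * c (p.2.1, β) := by
  rw [Fintype.sum_prod_type]
  simp only [Finset.sum_ite_irrel, Finset.sum_const_zero, Finset.sum_ite_eq', Finset.mem_univ,
    if_true]
  rw [Fintype.sum_prod_type]
  simp only [Matrix.one_apply, mul_ite, mul_one, mul_zero, ite_mul, zero_mul]
  rw [Finset.sum_comm]
  simp only [Finset.sum_ite_eq, Finset.mem_univ, if_true, Finset.mul_sum]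
  refine Finset.sum_congr rfl fun β _ => ?_
  ring

/-- Backward hop of a constant field at `U = 1`, generic spin matrix `T`. [folklore] -/
theorem sum_bwd_const {L : ℕ} [NeZero L] (p : QuarkIdx L) (μ : Fin 4)
    (T : Matrix (Fin 4) (Fin 4) ℂ) (c : Fin 3 × Fin 4 → ℂ) (k : ℂ) :
    ∑ q : QuarkIdx L, (if p.1 = Site.shift q.1 μ then
        k * (T p.2.2 q.2.2 * (1 : Matrix (Fin 3) (Fin 3) ℂ) p.2.1 q.2.1) * c q.2 else 0)
      = k * ∑ β, T p.2.2 β * c (p.2.1, β) := by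
  simp only [eq_shift_iff]
  rw [Fintype.sum_prod_type]
  simp only [Finset.sum_ite_irrel, Finset.sum_const_zero, Finset.sum_ite_eq', Finset.mem_univ,
    if_true]
  rw [Fintype.sum_prod_type]
  simp only [Matrix.one_apply, mul_ite, mul_one, mul_zero, ite_mul, zero_mul]
  rw [Finset.sum_comm]
  simp only [Finset.sum_ite_eq, Finset.mem_univ, if_true, Finset.mul_sum]
  refine Finset.sum_congr rfl fun β _ => ?_
  ring

/-- At the trivial gauge field the constant colour–spinors are eigenvectors of `D_W(1, m₀, 1)` with
eigenvalue `m₀` (the 12 zero-momentum modes; the `γ_μ` parts of the two hops cancel and the Wilson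
parts give `-4`). [folklore] -/
theorem wilsonDirac_one_mulVec_const {L : ℕ} [NeZero L] (m₀ : ℝ) (c : Fin 3 × Fin 4 → ℂ) :
    wilsonDirac (fundamentalRep (Fin 3)) (1 : GaugeConfig 4 L SU3) m₀ 1 *ᵥ (fun p => c p.2) =
      fun p => (m₀ : ℂ) * c p.2 := by
  funext p
  rw [mulVec, dotProduct]
  simp only [wilsonDirac, Matrix.of_apply, Pi.one_apply, map_one, inv_one, sub_mul,
    Finset.sum_sub_distrib, ite_mul, zero_mul, Finset.sum_ite_eq, Finset.mem_univ, if_true]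
  simp only [Finset.mul_sum, Finset.sum_mul, mul_add, add_mul, Finset.sum_add_distrib, ite_mul,
    zero_mul, mul_ite, mul_zero]
  rw [Finset.sum_comm (s := (Finset.univ : Finset (QuarkIdx L))) (t := (Finset.univ : Finset (Fin 4))),
    Finset.sum_comm (s := (Finset.univ : Finset (QuarkIdx L))) (t := (Finset.univ : Finset (Fin 4)))]
  simp only [sum_fwd_const, sum_bwd_const]
  have hT : ∀ μ β, ((((1 : ℝ) : ℂ) • (1 : Matrix (Fin 4) (Fin 4) ℂ) - euclideanGamma μ) p.2.2 β) * c (p.2.1, β) +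
      ((((1 : ℝ) : ℂ) • (1 : Matrix (Fin 4) (Fin 4) ℂ) + euclideanGamma μ) p.2.2 β) * c (p.2.1, β) =
      2 * ((1 : Matrix (Fin 4) (Fin 4) ℂ) p.2.2 β * c (p.2.1, β)) := by
    intro μ β
    simp only [Matrix.sub_apply, Matrix.add_apply, Matrix.smul_apply, smul_eq_mul, Complex.ofReal_one,
      one_mul]
    ring
  rw [← Finset.sum_add_distrib]
  simp_rw [← mul_add, ← Finset.sum_add_distrib, hT, ← Finset.mul_sum]
  simp only [Matrix.one_apply, ite_mul, one_mul, zero_mul, Finset.sum_ite_eq, Finset.mem_univ,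
    if_true, Finset.sum_const, Finset.card_univ, Fintype.card_fin, nsmul_eq_mul]
  push_cast
  ring

/-- **Free toron modes are window modes.**  At the trivial gauge field, for every bare mass `m₀` and
every `ε > |m₀|`, `γ₅ D_W(1, m₀, 1)` has an eigenvalue in `(-ε, ε)`: `N(ε; 1, m₀) ≥ 1` on every torus
`L ≥ 1` (indeed `= 12` for small `ε`; by gauge invariance the same holds on the whole pure-gauge
orbit, and by continuity on a neighbourhood of it — the configurations the toron floor is about).
[folklore] -/
theorem window_one_pos {L : ℕ} [NeZero L] {m₀ ε : ℝ} (h : |m₀| < ε) :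
    0 < Multiset.countP (fun z : ℂ => |z.re| < ε)
      (spinorLift gammaFive *
        wilsonDirac (fundamentalRep (Fin 3)) (1 : GaugeConfig 4 L SU3) m₀ 1).charpoly.roots := by
  obtain ⟨hlo, hhi⟩ := abs_lt.1 h
  set c : Fin 3 × Fin 4 → ℂ := fun s => if s = (0, 0) then 1 else 0 with hc
  set S : ℝ := ∑ p : QuarkIdx L, ‖c p.2‖ ^ 2 with hS
  have hS1 : 1 ≤ S := by
    have := Finset.single_le_sum (f := fun p : QuarkIdx L => ‖c p.2‖ ^ 2) (fun p _ => by positivity)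
      (Finset.mem_univ ((0 : TorusSite 4 L), (0 : Fin 3), (0 : Fin 4)))
    simpa [hc] using this
  have hSpos : 0 < S := by linarith
  set r : ℝ := (Real.sqrt S)⁻¹ with hr
  have hr2 : r ^ 2 * S = 1 := by
    rw [hr, inv_pow, Real.sq_sqrt hSpos.le, inv_mul_cancel₀ hSpos.ne']
  set v : QuarkIdx L → ℂ := fun p => (r : ℂ) * c p.2 with hv
  have hv1 : ∑ p, ‖v p‖ ^ 2 = 1 := by
    simp only [hv, norm_mul, mul_pow, Complex.norm_real, Real.norm_eq_abs, sq_abs]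
    rw [← Finset.mul_sum]
    exact hr2
  have hDv : wilsonDirac (fundamentalRep (Fin 3)) (1 : GaugeConfig 4 L SU3) m₀ 1 *ᵥ v =
      fun p => (m₀ : ℂ) * v p :=
    wilsonDirac_one_mulVec_const (L := L) m₀ (fun s => (r : ℂ) * c s)
  refine window_pos_of_small_image (1 : GaugeConfig 4 L SU3) ((abs_nonneg m₀).trans h.le) v hv1 ?_
  rw [hDv]
  simp only [norm_mul, mul_pow, Complex.norm_real, Real.norm_eq_abs, sq_abs]
  rw [← Finset.mul_sum, hv1, mul_one]
  exact sq_lt_sq' hlo hhi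

end FreeToron



end Summit.QuantumFields.QCD.Theorems.WegnerEstimateNegative
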